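import Literature.MathematicalPhysics.QuantumFieldTheory.Balaban1983to89.Node00.TwoRunSiteNear
import Literature.MathematicalPhysics.QuantumFieldTheory.BalabanFormatDensity

/-!
# NODE 00 — BRIDGE: `Node00.SupNear` (integer-residue form on `Setup.Site P j`) IS the tree's `Literature.MathematicalPhysics.QuantumFieldTheory.SiteNear` (`ZMod.val` form on
# the torus `Site d L` of `BalabanFormatDensity`) on the common carrier `Fin P.d → ZMod (P.sitesPerDir j)` — one `iff`, so that the two spellings are one notion of record

Cell `pub-ymgap`, YM-PLAN Track A (HUMAN RULING D-0062); seat `pub-ymgap-dag-n20-d` (R134 (a) N20 NE7b s3) gen 34 — answers dag-lead's NOTION NOTE on INTENT-4 (pub-ymgap INBOX,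
2026-08-29 ≈19:22Z: «the tree ALREADY HAS `…QuantumFieldTheory.SiteNear` … IF the Node00 two-run site type differs, keep yours but cite the twin and, cheaply, add the bridge»).
The carriers agree definitionally (`Setup.Site P j := Fin P.d → ZMod (P.sitesPerDir j)` is the abbrev torus `Site P.d (P.sitesPerDir j)` of `BalabanFormatDensity` under a
`def`); `Node00/TwoRunSiteNear` keeps its own two-line relation `SupNear` so that NODE 00 and the K-kit do not import the 2 000-line `BalabanFormatDensity` module of another
route; THIS file — imported by no K-kit module — identifies the two: ★ `supNear_iff_siteNear`.  Pure `ZMod` arithmetic; nothing of Bałaban's asserted; no count moves; no `def`,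
no `instance`, no `notation`, no `sorry`.
-/

namespace Literature.MathematicalPhysics.QuantumFieldTheory.Balaban1983to89.Node00

open T4Continuum

variable {P : Params} {j : ℕ}

/-- ★ **THE TWO SPELLINGS OF SUP-DISTANCE PROXIMITY AGREE**: for sites `z z′ : Setup.Site P j` (= `Fin P.d → ZMod (P.sitesPerDir j)`), `Node00.SupNear ϱ z z′` (every
coordinate of `z′ − z` is the residue of an integer of absolute value `≤ ϱ`) iff `Literature.MathematicalPhysics.QuantumFieldTheory.SiteNear ϱ z z′` (`val (z μ − z′ μ) ≤ ϱ` or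
`val (z′ μ − z μ) ≤ ϱ` in each coordinate). [cite: Balaban1989LargeFieldII, (1.84) p.386 (bookkeeping)] -/
theorem supNear_iff_siteNear (ϱ : ℕ) (z z' : Site P j) :
    SupNear ϱ z z' ↔ Literature.MathematicalPhysics.QuantumFieldTheory.SiteNear (d := P.d) (L := P.sitesPerDir j) ϱ z z' := by
  unfold SupNear Literature.MathematicalPhysics.QuantumFieldTheory.SiteNear
  refine forall_congr' fun μ => ⟨?_, ?_⟩
  · rintro ⟨δ, hδ, hzz⟩
    rcases le_or_gt 0 δ with h0 | h0
    · -- `z′ μ − z μ = δ ≥ 0`: the second disjunct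
      right
      have hδn : ((δ.toNat : ℕ) : ℤ) = δ := Int.toNat_of_nonneg h0
      have hcast : (δ : ZMod (P.sitesPerDir j)) = ((δ.toNat : ℕ) : ZMod (P.sitesPerDir j)) := by
        rw [← hδn, Int.cast_natCast, hδn]
      rw [hzz, hcast, ZMod.val_natCast]
      exact (Nat.mod_le _ _).trans (by have := abs_le.1 hδ; omega)
    · -- `z μ − z′ μ = −δ > 0`: the first disjunct
      left
      have hδn : (((-δ).toNat : ℕ) : ℤ) = -δ := Int.toNat_of_nonneg (by omega)
      have hneg : z μ - z' μ = (((-δ : ℤ)) : ZMod (P.sitesPerDir j)) := by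
        rw [Int.cast_neg, ← hzz, neg_sub]
      have hcast : ((-δ : ℤ) : ZMod (P.sitesPerDir j)) = (((-δ).toNat : ℕ) : ZMod (P.sitesPerDir j)) := by
        rw [← hδn, Int.cast_natCast, hδn]
      rw [hneg, hcast, ZMod.val_natCast]
      exact (Nat.mod_le _ _).trans (by have := abs_le.1 hδ; omega)
  · rintro (h | h)
    · -- `val (z μ − z′ μ) ≤ ϱ`: take `δ = −val`
      refine ⟨-((z μ - z' μ).val : ℤ), by rw [abs_neg, Nat.abs_cast]; exact_mod_cast h, ?_⟩
      rw [Int.cast_neg, Int.cast_natCast, ZMod.natCast_zmod_val, neg_sub]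
    · -- `val (z′ μ − z μ) ≤ ϱ`: take `δ = val`
      refine ⟨((z' μ - z μ).val : ℤ), by rw [Nat.abs_cast]; exact_mod_cast h, ?_⟩
      rw [Int.cast_natCast, ZMod.natCast_zmod_val]

end Literature.MathematicalPhysics.QuantumFieldTheory.Balaban1983to89.Node00
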